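import Mathlib
import Summits.AnomalousDissipation.AnomalousDissipation.Theorems.MarginalStabilityChainStretchedVortexRowsStubRowVorticityConstructionToolsSmooth
import Summits.AnomalousDissipation.AnomalousDissipation.Theorems.MarginalStabilityChainStretchedVortexRowsStubRowVorticityConstructionToolsStrip

/-!
# Stub `stub_rowVorticityConstruction` (crux stmt-AnomalousDissipation-3009) — tools IV:
# the cylinder Biot–Savart integrals are smooth, `L`-periodic and point-symmetric

Helper file (supports stmt-AnomalousDissipation-3009). For `L > 0` and a plane field `ω x y` let
`S_L = (−L/2, L/2] × ℝ` and, for a kernel `k` on `ℝ × ℝ`, `(k ⋆ ω)(x, y) = ∫_{S_L} k(q) ω(x − q₁, y − q₂) dq`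
(KERNEL-FIRST strip convolution). The cylinder Biot–Savart law of `stub_rowVorticityConstruction` is
`u = −(2L)⁻¹ K₁ ⋆ ω`, `v = (2L)⁻¹ K₂ ⋆ ω`, stream function `ψ = (4π)⁻¹ Φ_L ⋆ ω`
(`K₁(q) = sinh/(cosh − cos)`, `K₂(q) = sin/(cosh − cos)`, `Φ_L = log(cosh − cos)` at `(2πq₁/L, 2πq₂/L)`).
Proved here, for a general kernel and then for these three:

* `rowConv_add_period` — `k ⋆ ω` is `L`-periodic in `x` when `ω` is (pointwise in the integrand);
* `setIntegral_strip_comp_neg` — `∫_{S_L} F(−q) dq = ∫_{S_L} F(q) dq` (Lebesgue measure is reflection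
  invariant and `−S_L = [−L/2, L/2) × ℝ` differs from `S_L` by a null set);
* `rowConv_neg_neg_of_odd/even` — for point-symmetric `ω` (`ω(−x,−y) = ω(x,y)`), `k ⋆ ω` is odd for odd `k`
  (`K₁, K₂`: the velocity is point-antisymmetric, `u(−x,−y) = −u(x,y)`) and even for even `k` (`Φ_L`);
* `contDiff_rowBS_u/v/psi` — `Cⁿ` smoothness of `u, v, ψ` for `ω ∈ Cⁿ` with Gaussian bounds on `D^i ω` (`i ≤ n`)
  (tools II `contDiff_rowConv` + tools III `gaussTestable_rowKerU/V/LogKer`).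
Registered sub-goal proved here: `stub_rowVorticityConstruction_biotSavartSymm`. All `[folklore]`.
-/

set_option linter.dupNamespace false

noncomputable section

open Real Set Filter Topology MeasureTheory
open Literature.Analysis.FluidPDE Literature.Analysis.FluidPDE.StretchedLayer

namespace Summit.AnomalousDissipation.AnomalousDissipation.Theorems.MarginalStabilityChainStretchedVortexRows.RowBiotSavart

/-! ### Periodicity -/

/-- The kernel-first convolution of an `L`-periodic field is `L`-periodic (any measure, any kernel).
[folklore] -/
theorem rowConv_add_period {μ : Measure (ℝ × ℝ)} (k : ℝ × ℝ → ℝ) {ω : ℝ → ℝ → ℝ} {L : ℝ}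
    (hω : ∀ x y, ω (x + L) y = ω x y) (x y : ℝ) :
    ∫ q, k q * ω (x + L - q.1) (y - q.2) ∂μ = ∫ q, k q * ω (x - q.1) (y - q.2) ∂μ := by
  refine integral_congr_ae (Eventually.of_forall fun q => ?_)
  simp only
  rw [show x + L - q.1 = x - q.1 + L by ring, hω]

/-! ### Reflection -/

/-- The reflected period strip is the half-open strip closed on the other side. [folklore] -/
theorem neg_strip (L : ℝ) :
    -(Ioc (-(L / 2)) (L / 2) ×ˢ (univ : Set ℝ)) = Ico (-(L / 2)) (L / 2) ×ˢ (univ : Set ℝ) := by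
  ext q
  simp only [Set.mem_neg, mem_prod, mem_Ioc, mem_univ, and_true, mem_Ico, Prod.fst_neg]
  constructor <;> rintro ⟨h1, h2⟩ <;> constructor <;> linarith

/-- The reflected strip equals the strip up to a Lebesgue-null set. [folklore] -/
theorem neg_strip_ae_eq (L : ℝ) :
    (-(Ioc (-(L / 2)) (L / 2) ×ˢ (univ : Set ℝ)) : Set (ℝ × ℝ)) =ᵐ[volume]
      (Ioc (-(L / 2)) (L / 2) ×ˢ (univ : Set ℝ) : Set (ℝ × ℝ)) := by
  rw [neg_strip, show (volume : Measure (ℝ × ℝ)) = (volume : Measure ℝ).prod (volume : Measure ℝ) from rfl]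
  exact Measure.set_prod_ae_eq Ico_ae_eq_Ioc EventuallyEq.rfl

/-- **Reflection invariance of the strip integral**: `∫_{S_L} F(−q) dq = ∫_{S_L} F(q) dq`. [folklore] -/
theorem setIntegral_strip_comp_neg {E : Type*} [NormedAddCommGroup E] [NormedSpace ℝ E] (L : ℝ)
    (F : ℝ × ℝ → E) :
    ∫ q in Ioc (-(L / 2)) (L / 2) ×ˢ (univ : Set ℝ), F (-q) =
      ∫ q in Ioc (-(L / 2)) (L / 2) ×ˢ (univ : Set ℝ), F q := by
  set S : Set (ℝ × ℝ) := Ioc (-(L / 2)) (L / 2) ×ˢ (univ : Set ℝ)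
  have hm : MeasurePreserving (Neg.neg : ℝ × ℝ → ℝ × ℝ) volume volume :=
    Measure.measurePreserving_neg (volume : Measure (ℝ × ℝ))
  have h1 := hm.setIntegral_preimage_emb (MeasurableEquiv.neg (ℝ × ℝ)).measurableEmbedding F (-S)
  have hpre : (Neg.neg : ℝ × ℝ → ℝ × ℝ) ⁻¹' (-S) = S := by
    ext q; simp
  rw [hpre] at h1
  rw [h1]
  exact setIntegral_congr_set (neg_strip_ae_eq L)

/-- **Odd kernels give point-antisymmetric fields**: if `k(−q) = −k(q)` and `ω(−x,−y) = ω(x,y)` then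
`(k ⋆ ω)(−x,−y) = −(k ⋆ ω)(x,y)` (the case of the velocity kernels `K₁, K₂`). [folklore] -/
theorem rowConv_neg_neg_of_odd {k : ℝ × ℝ → ℝ} (hk : ∀ q, k (-q) = -k q) {ω : ℝ → ℝ → ℝ}
    (hω : ∀ x y, ω (-x) (-y) = ω x y) (L x y : ℝ) :
    ∫ q in Ioc (-(L / 2)) (L / 2) ×ˢ (univ : Set ℝ), k q * ω (-x - q.1) (-y - q.2) =
      -∫ q in Ioc (-(L / 2)) (L / 2) ×ˢ (univ : Set ℝ), k q * ω (x - q.1) (y - q.2) := by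
  rw [← integral_neg, ← setIntegral_strip_comp_neg L (fun q => -(k q * ω (x - q.1) (y - q.2)))]
  refine integral_congr_ae (Eventually.of_forall fun q => ?_)
  simp only [Prod.fst_neg, Prod.snd_neg, hk, sub_neg_eq_add, neg_mul, neg_neg]
  rw [show -x - q.1 = -(x + q.1) by ring, show -y - q.2 = -(y + q.2) by ring, hω]

/-- **Even kernels give point-symmetric fields**: if `k(−q) = k(q)` and `ω(−x,−y) = ω(x,y)` then
`(k ⋆ ω)(−x,−y) = (k ⋆ ω)(x,y)` (the case of the stream-function kernel `Φ_L`). [folklore] -/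
theorem rowConv_neg_neg_of_even {k : ℝ × ℝ → ℝ} (hk : ∀ q, k (-q) = k q) {ω : ℝ → ℝ → ℝ}
    (hω : ∀ x y, ω (-x) (-y) = ω x y) (L x y : ℝ) :
    ∫ q in Ioc (-(L / 2)) (L / 2) ×ˢ (univ : Set ℝ), k q * ω (-x - q.1) (-y - q.2) =
      ∫ q in Ioc (-(L / 2)) (L / 2) ×ˢ (univ : Set ℝ), k q * ω (x - q.1) (y - q.2) := by
  rw [← setIntegral_strip_comp_neg L (fun q => k q * ω (x - q.1) (y - q.2))]
  refine integral_congr_ae (Eventually.of_forall fun q => ?_)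
  simp only [Prod.fst_neg, Prod.snd_neg, hk, sub_neg_eq_add]
  rw [show -x - q.1 = -(x + q.1) by ring, show -y - q.2 = -(y + q.2) by ring, hω]

/-- `K₁` is odd under the point reflection (physical variables). [folklore] -/
theorem rowKerU_neg (L : ℝ) (q : ℝ × ℝ) :
    Real.sinh (2 * π * (-q).2 / L) / (Real.cosh (2 * π * (-q).2 / L) - Real.cos (2 * π * (-q).1 / L)) =
      -(Real.sinh (2 * π * q.2 / L) / (Real.cosh (2 * π * q.2 / L) - Real.cos (2 * π * q.1 / L))) := by
  simp only [Prod.snd_neg, Prod.fst_neg, mul_neg, neg_div, Real.sinh_neg, Real.cosh_neg, Real.cos_neg]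

/-- `K₂` is odd under the point reflection (physical variables). [folklore] -/
theorem rowKerV_neg (L : ℝ) (q : ℝ × ℝ) :
    Real.sin (2 * π * (-q).1 / L) / (Real.cosh (2 * π * (-q).2 / L) - Real.cos (2 * π * (-q).1 / L)) =
      -(Real.sin (2 * π * q.1 / L) / (Real.cosh (2 * π * q.2 / L) - Real.cos (2 * π * q.1 / L))) := by
  simp only [Prod.snd_neg, Prod.fst_neg, mul_neg, neg_div, Real.sin_neg, Real.cosh_neg, Real.cos_neg]

/-- `Φ_L` is even under the point reflection (physical variables). [folklore] -/
theorem rowLogKer_neg (L : ℝ) (q : ℝ × ℝ) :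
    Real.log (Real.cosh (2 * π * (-q).2 / L) - Real.cos (2 * π * (-q).1 / L)) =
      Real.log (Real.cosh (2 * π * q.2 / L) - Real.cos (2 * π * q.1 / L)) := by
  simp only [Prod.snd_neg, Prod.fst_neg, mul_neg, neg_div, Real.cosh_neg, Real.cos_neg]

/-! ### Smoothness of `u`, `v`, `ψ` -/

section Smooth

variable {L : ℝ} {n : ℕ} {ω : ℝ → ℝ → ℝ}

/-- **`u = −(2L)⁻¹ K₁ ⋆ ω` is `Cⁿ`** for `ω ∈ Cⁿ` with Gaussian bounds on `D^i ω`, `i ≤ n`. [folklore] -/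
theorem contDiff_rowBS_u (hL : 0 < L) (hω : ContDiff ℝ n fun p : ℝ × ℝ => ω p.1 p.2)
    (hB : ∀ i ≤ n, ∃ C a : ℝ, 0 < a ∧
      ∀ p, ‖iteratedFDeriv ℝ i (fun p : ℝ × ℝ => ω p.1 p.2) p‖ ≤ C * Real.exp (-a * p.2 ^ 2)) :
    ContDiff ℝ n fun p : ℝ × ℝ => -(1 / (2 * L)) *
      ∫ q in Ioc (-(L / 2)) (L / 2) ×ˢ (univ : Set ℝ),
        Real.sinh (2 * π * q.2 / L) / (Real.cosh (2 * π * q.2 / L) - Real.cos (2 * π * q.1 / L)) *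
          ω (p.1 - q.1) (p.2 - q.2) :=
  contDiff_const.mul (contDiff_rowConv (measurable_rowKerU L).aestronglyMeasurable
    (gaussTestable_rowKerU hL) n hω hB)

/-- **`v = (2L)⁻¹ K₂ ⋆ ω` is `Cⁿ`** for `ω ∈ Cⁿ` with Gaussian bounds on `D^i ω`, `i ≤ n`. [folklore] -/
theorem contDiff_rowBS_v (hL : 0 < L) (hω : ContDiff ℝ n fun p : ℝ × ℝ => ω p.1 p.2)
    (hB : ∀ i ≤ n, ∃ C a : ℝ, 0 < a ∧
      ∀ p, ‖iteratedFDeriv ℝ i (fun p : ℝ × ℝ => ω p.1 p.2) p‖ ≤ C * Real.exp (-a * p.2 ^ 2)) :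
    ContDiff ℝ n fun p : ℝ × ℝ => 1 / (2 * L) *
      ∫ q in Ioc (-(L / 2)) (L / 2) ×ˢ (univ : Set ℝ),
        Real.sin (2 * π * q.1 / L) / (Real.cosh (2 * π * q.2 / L) - Real.cos (2 * π * q.1 / L)) *
          ω (p.1 - q.1) (p.2 - q.2) :=
  contDiff_const.mul (contDiff_rowConv (measurable_rowKerV L).aestronglyMeasurable
    (gaussTestable_rowKerV hL) n hω hB)

/-- **`ψ = (4π)⁻¹ Φ_L ⋆ ω` is `Cⁿ`** for `ω ∈ Cⁿ` with Gaussian bounds on `D^i ω`, `i ≤ n`. [folklore] -/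
theorem contDiff_rowBS_psi (hL : 0 < L) (hω : ContDiff ℝ n fun p : ℝ × ℝ => ω p.1 p.2)
    (hB : ∀ i ≤ n, ∃ C a : ℝ, 0 < a ∧
      ∀ p, ‖iteratedFDeriv ℝ i (fun p : ℝ × ℝ => ω p.1 p.2) p‖ ≤ C * Real.exp (-a * p.2 ^ 2)) :
    ContDiff ℝ n fun p : ℝ × ℝ => 1 / (4 * π) *
      ∫ q in Ioc (-(L / 2)) (L / 2) ×ˢ (univ : Set ℝ),
        Real.log (Real.cosh (2 * π * q.2 / L) - Real.cos (2 * π * q.1 / L)) * ω (p.1 - q.1) (p.2 - q.2) :=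
  contDiff_const.mul (contDiff_rowConv (measurable_rowLogKer L).aestronglyMeasurable
    (gaussTestable_rowLogKer hL) n hω hB)

end Smooth

end RowBiotSavart

open RowBiotSavart in
/-- **The cylinder Biot–Savart velocity of a point-symmetric `L`-periodic vorticity is `L`-periodic and
point-antisymmetric** (registered on stmt-AnomalousDissipation-3009 as the helper stub
`stub_rowVorticityConstruction_biotSavartSymm` of `stub_rowVorticityConstruction`): for every `L` and
every `ω` with `ω(x + L, y) = ω(x, y)` and `ω(−x, −y) = ω(x, y)`, the fields
`u = −(2L)⁻¹ ∫_{S_L} K₁(q) ω(x − q₁, y − q₂) dq`, `v = (2L)⁻¹ ∫_{S_L} K₂(q) ω(x − q₁, y − q₂) dq` satisfy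
`u(x+L,y) = u(x,y)`, `v(x+L,y) = v(x,y)`, `u(−x,−y) = −u(x,y)`, `v(−x,−y) = −v(x,y)` — the periodicity and
point-symmetry clauses of the stub's conclusion for the reconstructed velocity. [folklore] -/
theorem stub_rowVorticityConstruction_biotSavartSymm :
    ∀ (L : ℝ) (ω : ℝ → ℝ → ℝ), (∀ x y, ω (x + L) y = ω x y) → (∀ x y, ω (-x) (-y) = ω x y) →
      ∀ x y : ℝ,
        (-(1 / (2 * L)) * ∫ q in Set.Ioc (-(L / 2)) (L / 2) ×ˢ (Set.univ : Set ℝ),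
            Real.sinh (2 * Real.pi * q.2 / L) / (Real.cosh (2 * Real.pi * q.2 / L) - Real.cos (2 * Real.pi * q.1 / L)) *
              ω (x + L - q.1) (y - q.2)) =
          -(1 / (2 * L)) * ∫ q in Set.Ioc (-(L / 2)) (L / 2) ×ˢ (Set.univ : Set ℝ),
            Real.sinh (2 * Real.pi * q.2 / L) / (Real.cosh (2 * Real.pi * q.2 / L) - Real.cos (2 * Real.pi * q.1 / L)) *
              ω (x - q.1) (y - q.2) ∧
        (1 / (2 * L) * ∫ q in Set.Ioc (-(L / 2)) (L / 2) ×ˢ (Set.univ : Set ℝ),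
            Real.sin (2 * Real.pi * q.1 / L) / (Real.cosh (2 * Real.pi * q.2 / L) - Real.cos (2 * Real.pi * q.1 / L)) *
              ω (x + L - q.1) (y - q.2)) =
          1 / (2 * L) * ∫ q in Set.Ioc (-(L / 2)) (L / 2) ×ˢ (Set.univ : Set ℝ),
            Real.sin (2 * Real.pi * q.1 / L) / (Real.cosh (2 * Real.pi * q.2 / L) - Real.cos (2 * Real.pi * q.1 / L)) *
              ω (x - q.1) (y - q.2) ∧
        (-(1 / (2 * L)) * ∫ q in Set.Ioc (-(L / 2)) (L / 2) ×ˢ (Set.univ : Set ℝ),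
            Real.sinh (2 * Real.pi * q.2 / L) / (Real.cosh (2 * Real.pi * q.2 / L) - Real.cos (2 * Real.pi * q.1 / L)) *
              ω (-x - q.1) (-y - q.2)) =
          -(-(1 / (2 * L)) * ∫ q in Set.Ioc (-(L / 2)) (L / 2) ×ˢ (Set.univ : Set ℝ),
            Real.sinh (2 * Real.pi * q.2 / L) / (Real.cosh (2 * Real.pi * q.2 / L) - Real.cos (2 * Real.pi * q.1 / L)) *
              ω (x - q.1) (y - q.2)) ∧
        (1 / (2 * L) * ∫ q in Set.Ioc (-(L / 2)) (L / 2) ×ˢ (Set.univ : Set ℝ),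
            Real.sin (2 * Real.pi * q.1 / L) / (Real.cosh (2 * Real.pi * q.2 / L) - Real.cos (2 * Real.pi * q.1 / L)) *
              ω (-x - q.1) (-y - q.2)) =
          -(1 / (2 * L) * ∫ q in Set.Ioc (-(L / 2)) (L / 2) ×ˢ (Set.univ : Set ℝ),
            Real.sin (2 * Real.pi * q.1 / L) / (Real.cosh (2 * Real.pi * q.2 / L) - Real.cos (2 * Real.pi * q.1 / L)) *
              ω (x - q.1) (y - q.2)) := by
  intro L ω hper hsym x y
  refine ⟨by rw [rowConv_add_period _ hper], by rw [rowConv_add_period _ hper], ?_, ?_⟩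
  · rw [rowConv_neg_neg_of_odd (fun q => rowKerU_neg L q) hsym, mul_neg]
  · rw [rowConv_neg_neg_of_odd (fun q => rowKerV_neg L q) hsym, mul_neg]

end Summit.AnomalousDissipation.AnomalousDissipation.Theorems.MarginalStabilityChainStretchedVortexRows

end
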